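import Literature.Analysis.FluidPDE.RadialCalculus
import Summits.NavierStokesRegularity.NavierStokesRegularity.Theorems.ThreadingFluxHorizonTowerProfileCore
import HarnessLib

/-!
# The horizon profile, explicit part: `∇φ` and `div ∇φ` for `φ = ‖z‖^{1−l} H`, `H` harmonic of degree `l`
# (towards conjuncts (4)–(6) of `HorizonTower.HorizonProfileStructure`; crux `PoloidalLiouville`, W1)

Support file for crux `PoloidalLiouville` (line «horizon-threading-tower», ns-idea-15; ARM A `pub/ns-exp-scalarLiouville` g3,
DIRECTOR-NS #262 (2) option (B)).  Pure calculus on `ℝ³ ∖ {0}`: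

* local Leibniz rules: `gradient_mul_apply` (`∇(fg) = f∇g + g∇f`), `divergence_smul_apply`,
  `divergence_gradient_eq_laplacian_of_contDiffAt` (`div ∇φ = Δφ` for `φ` of class `C²` at the point),
  `gradient_comp_norm_sq` (`∇(g(‖·‖²))(z) = 2g′ z`);
* with `ρ(σ) = σ^{a}`, `a = (1 − l)/2`, `q = ‖x‖²` and `H` smooth, `l`-homogeneous and harmonic:
  `gradient_potential` — `∇φ(x) = ρ(q)∇H(x) + 2aq^{a−1}H(x)·x`, and
  `divergence_gradient_potential` — `div ∇φ(x) = (1−l)(l+2)·q^{a−1}·H(x)` (`= (1−l)(l+2)‖x‖^{−1−l}H`, the factor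
  `κ = (1−l)(l+2)`: `4lρ′ + 6ρ′ + 4qρ″` with Euler `⟪∇H, x⟫ = lH` and `ΔH = 0`).
Nothing here is specific to Navier–Stokes.
-/

-- the summit and its single problem share the name (D-0017 nested layout)
set_option linter.dupNamespace false

noncomputable section

open Set Function Filter Topology InnerProductSpace
open scoped Topology RealInnerProductSpace Laplacian

namespace Summit.NavierStokesRegularity.NavierStokesRegularity.Theorems.PoloidalLiouville.HorizonTower

open Literature.Analysis.FluidPDE PoloidalField

/-! ### Local Leibniz rules -/

/-- `∇(fg)(x) = f(x)∇g(x) + g(x)∇f(x)` at a point of differentiability. -/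
theorem gradient_mul_apply {f g : EuclideanSpace ℝ (Fin 3) → ℝ} {x : EuclideanSpace ℝ (Fin 3)}
    (hf : DifferentiableAt ℝ f x) (hg : DifferentiableAt ℝ g x) :
    gradient (fun z => f z * g z) x = f x • gradient g x + g x • gradient f x := by
  apply ext_inner_right ℝ
  intro v
  rw [inner_add_left, real_inner_smul_left, real_inner_smul_left, Literature.Analysis.FluidPDE.inner_gradient_left,
    Literature.Analysis.FluidPDE.inner_gradient_left, Literature.Analysis.FluidPDE.inner_gradient_left,
    fderiv_fun_mul hf hg]
  simp only [_root_.add_apply, _root_.FunLike.coe_smul, Pi.smul_apply, smul_eq_mul]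

/-- `div(θ u) = θ div u + Dθ[u]` at a point of differentiability. -/
theorem divergence_smul_apply {θ : EuclideanSpace ℝ (Fin 3) → ℝ}
    {u : EuclideanSpace ℝ (Fin 3) → EuclideanSpace ℝ (Fin 3)} {x : EuclideanSpace ℝ (Fin 3)}
    (hθ : DifferentiableAt ℝ θ x) (hu : DifferentiableAt ℝ u x) :
    VectorCalculus.divergence (fun y => θ y • u y) x =
      θ x * VectorCalculus.divergence u x + fderiv ℝ θ x (u x) := by
  let b := stdOrthonormalBasis ℝ (EuclideanSpace ℝ (Fin 3))
  rw [divergence_eq_sum_inner_fderiv b, divergence_eq_sum_inner_fderiv b, fderiv_fun_smul hθ hu,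
    Finset.mul_sum]
  simp only [_root_.add_apply, _root_.FunLike.coe_smul, Pi.smul_apply,
    ContinuousLinearMap.smulRight_apply, inner_add_right, Finset.sum_add_distrib,
    real_inner_smul_right]
  congr 1
  calc ∑ i, fderiv ℝ θ x (b i) * ⟪b i, u x⟫
      = fderiv ℝ θ x (∑ i, ⟪b i, u x⟫ • b i) := by simp [mul_comm]
    _ = fderiv ℝ θ x (u x) := by rw [b.sum_repr']

/-- `div ∇φ(x) = Δφ(x)` for `φ` of class `C²` at `x` (local form). -/
theorem divergence_gradient_eq_laplacian_of_contDiffAt {φ : EuclideanSpace ℝ (Fin 3) → ℝ}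
    {x : EuclideanSpace ℝ (Fin 3)} (hφ : ContDiffAt ℝ 2 φ x) :
    VectorCalculus.divergence (gradient φ) x = (Δ φ) x := by
  set b := stdOrthonormalBasis ℝ (EuclideanSpace ℝ (Fin 3))
  have hd : DifferentiableAt ℝ (fderiv ℝ φ) x := (hφ.fderiv_right (m := 1) (by norm_num)).differentiableAt (by simp)
  have hgrad : HasFDerivAt (gradient φ)
      (((InnerProductSpace.toDual ℝ (EuclideanSpace ℝ (Fin 3))).symm :
          (EuclideanSpace ℝ (Fin 3) →L[ℝ] ℝ) →L[ℝ] EuclideanSpace ℝ (Fin 3)).comp (fderiv ℝ (fderiv ℝ φ) x)) x :=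
    (InnerProductSpace.toDual ℝ (EuclideanSpace ℝ (Fin 3))).symm.hasFDerivAt.comp x hd.hasFDerivAt
  rw [divergence_eq_sum_inner_fderiv b,
    congrFun (laplacian_eq_iteratedFDeriv_orthonormalBasis φ b) x]
  refine Finset.sum_congr rfl fun i _ => ?_
  rw [iteratedFDeriv_two_apply, hgrad.fderiv, real_inner_comm]
  simp only [Matrix.cons_val_zero, Matrix.cons_val_one, ContinuousLinearMap.comp_apply]
  exact InnerProductSpace.toDual_symm_apply

/-- `∇(g(‖·‖²))(z) = (2g′(‖z‖²)) • z`. -/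
theorem gradient_comp_norm_sq {g : ℝ → ℝ} {g₁ : ℝ} {z : EuclideanSpace ℝ (Fin 3)}
    (hg : HasDerivAt g g₁ (‖z‖ ^ 2)) :
    gradient (fun w : EuclideanSpace ℝ (Fin 3) => g (‖w‖ ^ 2)) z = (2 * g₁) • z := by
  apply ext_inner_right ℝ
  intro v
  rw [Literature.Analysis.FluidPDE.inner_gradient_left, fderiv_comp_norm_sq_apply hg, real_inner_smul_left]

/-! ### The potential `H · (‖z‖²)^a` -/

section Potential

variable {H : EuclideanSpace ℝ (Fin 3) → ℝ} {l : ℕ} {a : ℝ}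

/-- Euler for degree `l`: `DH(x)[x] = l H(x)`. -/
theorem fderiv_apply_self_of_homogeneous_nat {x : EuclideanSpace ℝ (Fin 3)} (hH : DifferentiableAt ℝ H x)
    (hhom : ∀ (c : ℝ) (y : EuclideanSpace ℝ (Fin 3)), H (c • y) = c ^ l * H y) :
    fderiv ℝ H x x = (l : ℝ) * H x := by
  have hev : ∀ᶠ c in 𝓝 (1 : ℝ), H (c • x) = (fun c : ℝ => c ^ l) c • H x :=
    Eventually.of_forall fun c => by rw [hhom, smul_eq_mul]
  have ha : HasDerivAt (fun c : ℝ => c ^ l) ((l : ℝ)) 1 := by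
    simpa using hasDerivAt_pow l (1 : ℝ)
  have h := fderiv_apply_self_of_homogeneous (a := fun c : ℝ => c ^ l) hH ha hev
  rw [h, smul_eq_mul]

/-- The radial factor `z ↦ (‖z‖²)^a` off the origin: derivative data. -/
theorem hasDerivAt_rpow_normSq {x : EuclideanSpace ℝ (Fin 3)} (hx : x ≠ 0) (a : ℝ) :
    HasDerivAt (fun σ : ℝ => σ ^ a) (a * (‖x‖ ^ 2) ^ (a - 1)) (‖x‖ ^ 2) :=
  Real.hasDerivAt_rpow_const (Or.inl (by positivity))

/-- `z ↦ (‖z‖²)^a` is smooth off the origin. -/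
theorem contDiffAt_rpow_normSq {x : EuclideanSpace ℝ (Fin 3)} (hx : x ≠ 0) (a : ℝ) {n : WithTop ℕ∞} :
    ContDiffAt ℝ n (fun z : EuclideanSpace ℝ (Fin 3) => (‖z‖ ^ 2) ^ a) x := by
  have h1 : ContDiffAt ℝ n (fun z : EuclideanSpace ℝ (Fin 3) => ‖z‖ ^ 2) x := (contDiff_norm_sq ℝ).contDiffAt
  have h2 : ContDiffAt ℝ n (fun σ : ℝ => σ ^ a) (‖x‖ ^ 2) :=
    Real.contDiffAt_rpow_const_of_ne (by positivity)
  exact h2.comp x h1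

/-- **`∇(H · (‖·‖²)^a)(x) = (‖x‖²)^a ∇H(x) + 2a(‖x‖²)^{a−1}H(x) · x`** off the origin. -/
theorem gradient_mul_rpow_normSq {x : EuclideanSpace ℝ (Fin 3)} (hx : x ≠ 0) (hH : DifferentiableAt ℝ H x) (a : ℝ) :
    gradient (fun z : EuclideanSpace ℝ (Fin 3) => H z * (‖z‖ ^ 2) ^ a) x
      = ((‖x‖ ^ 2) ^ a) • gradient H x + (2 * (a * (‖x‖ ^ 2) ^ (a - 1)) * H x) • x := by
  have hρ : DifferentiableAt ℝ (fun z : EuclideanSpace ℝ (Fin 3) => (‖z‖ ^ 2) ^ a) x :=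
    (contDiffAt_rpow_normSq hx a (n := 1)).differentiableAt (by simp)
  rw [gradient_mul_apply hH hρ, gradient_comp_norm_sq (hasDerivAt_rpow_normSq hx a), smul_smul, add_comm]
  congr 1
  ring_nf

/-- **`div ∇(H · (‖·‖²)^a)(x) = a(4l + 4a + 2)(‖x‖²)^{a−1} H(x)`** off the origin, for `H` smooth, homogeneous of
degree `l` and harmonic (`4l a + 6a + 4a(a−1)` from the two Leibniz terms, with Euler `DH(x)[x] = lH` and `div ∇H = ΔH = 0`). -/
theorem divergence_gradient_mul_rpow_normSq {x : EuclideanSpace ℝ (Fin 3)} (hx : x ≠ 0)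
    (hH : ContDiff ℝ (⊤ : ℕ∞) H) (hhom : ∀ (c : ℝ) (y : EuclideanSpace ℝ (Fin 3)), H (c • y) = c ^ l * H y)
    (hharm : ∀ y, Laplacian.laplacian H y = 0) (a : ℝ) :
    VectorCalculus.divergence (gradient (fun z : EuclideanSpace ℝ (Fin 3) => H z * (‖z‖ ^ 2) ^ a)) x
      = a * (4 * l + 4 * a + 2) * (‖x‖ ^ 2) ^ (a - 1) * H x := by
  have hq0 : 0 < ‖x‖ ^ 2 := by positivity
  have hHd : ∀ z, DifferentiableAt ℝ H z := fun z => (hH.differentiable (by simp)).differentiableAt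
  -- `∇φ` near `x`
  have hev : gradient (fun z : EuclideanSpace ℝ (Fin 3) => H z * (‖z‖ ^ 2) ^ a) =ᶠ[𝓝 x]
      fun z => ((‖z‖ ^ 2) ^ a) • gradient H z + (2 * (a * (‖z‖ ^ 2) ^ (a - 1)) * H z) • z := by
    filter_upwards [isOpen_compl_singleton.mem_nhds hx] with z hz
    exact gradient_mul_rpow_normSq hz (hHd z) a
  have hH2 : ContDiff ℝ 2 H := hH.of_le (by norm_cast)
  rw [show VectorCalculus.divergence (gradient (fun z : EuclideanSpace ℝ (Fin 3) => H z * (‖z‖ ^ 2) ^ a)) x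
      = VectorCalculus.divergence (fun z : EuclideanSpace ℝ (Fin 3) =>
          ((‖z‖ ^ 2) ^ a) • gradient H z + (2 * (a * (‖z‖ ^ 2) ^ (a - 1)) * H z) • z) x by
    simp only [VectorCalculus.divergence, hev.fderiv_eq]]
  -- differentiability of the pieces at `x`
  have hρ : DifferentiableAt ℝ (fun z : EuclideanSpace ℝ (Fin 3) => (‖z‖ ^ 2) ^ a) x :=
    (contDiffAt_rpow_normSq hx a (n := 1)).differentiableAt (by simp)
  have hρ' : DifferentiableAt ℝ (fun z : EuclideanSpace ℝ (Fin 3) => (‖z‖ ^ 2) ^ (a - 1)) x :=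
    (contDiffAt_rpow_normSq hx (a - 1) (n := 1)).differentiableAt (by simp)
  have hgH : DifferentiableAt ℝ (gradient H) x := by
    have hD : DifferentiableAt ℝ (fderiv ℝ H) x :=
      (hH2.contDiffAt.fderiv_right (m := 1) (by norm_num)).differentiableAt (by simp)
    exact ((InnerProductSpace.toDual ℝ (EuclideanSpace ℝ (Fin 3))).symm.differentiableAt).comp x hD
  have hc : DifferentiableAt ℝ (fun z : EuclideanSpace ℝ (Fin 3) => 2 * (a * (‖z‖ ^ 2) ^ (a - 1)) * H z) x :=
    ((hρ'.const_mul a).const_mul 2).mul (hHd x)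
  have h1 : DifferentiableAt ℝ (fun z : EuclideanSpace ℝ (Fin 3) => ((‖z‖ ^ 2) ^ a) • gradient H z) x :=
    hρ.smul hgH
  have h2 : DifferentiableAt ℝ
      (fun z : EuclideanSpace ℝ (Fin 3) => (2 * (a * (‖z‖ ^ 2) ^ (a - 1)) * H z) • z) x :=
    hc.smul differentiableAt_id
  have hsmul2 := divergence_smul_apply (u := fun y => y) hc differentiableAt_id
  have hadd : VectorCalculus.divergence (fun z : EuclideanSpace ℝ (Fin 3) =>
        ((‖z‖ ^ 2) ^ a) • gradient H z + (2 * (a * (‖z‖ ^ 2) ^ (a - 1)) * H z) • z) x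
      = VectorCalculus.divergence (fun z : EuclideanSpace ℝ (Fin 3) => ((‖z‖ ^ 2) ^ a) • gradient H z) x
        + VectorCalculus.divergence (fun z : EuclideanSpace ℝ (Fin 3) => (2 * (a * (‖z‖ ^ 2) ^ (a - 1)) * H z) • z) x := by
    simp only [VectorCalculus.divergence, fderiv_fun_add h1 h2, ContinuousLinearMap.toLinearMap_add, map_add]
  rw [hadd, divergence_smul_apply hρ hgH, hsmul2,
    Sverak2011.divergence_id_three, divergence_gradient_eq_laplacian_of_contDiffAt hH2.contDiffAt, hharm x,
    mul_zero, zero_add]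
  -- `D(q^a)(x)[∇H x] = 2a q^{a-1} ⟪x, ∇H x⟫ = 2a q^{a-1} l H x`
  have hEuler : fderiv ℝ H x x = (l : ℝ) * H x := fderiv_apply_self_of_homogeneous_nat (hHd x) hhom
  have hinner : ⟪x, gradient H x⟫ = (l : ℝ) * H x := by
    rw [real_inner_comm, Literature.Analysis.FluidPDE.inner_gradient_left, hEuler]
  rw [fderiv_comp_norm_sq_apply (hasDerivAt_rpow_normSq hx a), hinner]
  -- `D(2a q^{a-1} H)(x)[x] = 2a (2(a-1) q^{a-2} q) H + 2a q^{a-1} l H`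
  have hprod : fderiv ℝ (fun z : EuclideanSpace ℝ (Fin 3) => 2 * (a * (‖z‖ ^ 2) ^ (a - 1)) * H z) x x
      = 2 * (a * (2 * ((a - 1) * (‖x‖ ^ 2) ^ (a - 1 - 1)) * ‖x‖ ^ 2)) * H x
        + 2 * (a * (‖x‖ ^ 2) ^ (a - 1)) * ((l : ℝ) * H x) := by
    rw [fderiv_fun_mul ((hρ'.const_mul a).const_mul 2) (hHd x)]
    simp only [_root_.add_apply, _root_.FunLike.coe_smul, Pi.smul_apply, smul_eq_mul, hEuler]
    rw [fderiv_const_mul (hρ'.const_mul a), fderiv_const_mul hρ']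
    simp only [_root_.FunLike.coe_smul, Pi.smul_apply, smul_eq_mul]
    rw [fderiv_comp_norm_sq_apply (hasDerivAt_rpow_normSq hx (a - 1)), real_inner_self_eq_norm_sq]
    ring
  rw [hprod]
  have hpow : (‖x‖ ^ 2) ^ (a - 1 - 1) * ‖x‖ ^ 2 = (‖x‖ ^ 2) ^ (a - 1) := by
    rw [← Real.rpow_add_one hq0.ne' (a - 1 - 1)]; ring_nf
  have hpow' : (‖x‖ ^ 2) ^ (a - 1 - 1) * ‖x‖ ^ 2 * H x = (‖x‖ ^ 2) ^ (a - 1) * H x := by rw [hpow]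
  linear_combination (2 * (a * (2 * (a - 1)))) * hpow'

end Potential

/-! ### Conjuncts (4) and (5) of `HorizonProfileStructure` -/

section Formulas

variable {l : ℕ} {H : EuclideanSpace ℝ (Fin 3) → ℝ}

/-- Off the origin, `‖z‖^{(1:ℤ)−l} H(z) = H(z)·(‖z‖²)^{(1−l)/2}`. -/
theorem potential_eq_rpow {z : EuclideanSpace ℝ (Fin 3)} (hz : z ≠ 0) :
    ‖z‖ ^ ((1 : ℤ) - l) * H z = H z * (‖z‖ ^ 2) ^ (((1 : ℝ) - l) / 2) := by
  have hr : 0 < ‖z‖ := norm_pos_iff.2 hz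
  have h1 : (‖z‖ ^ 2) ^ (((1 : ℝ) - l) / 2) = ‖z‖ ^ ((1 : ℝ) - l) := by
    rw [← Real.rpow_natCast ‖z‖ 2, ← Real.rpow_mul hr.le]
    congr 1; push_cast; ring
  have h2 : ‖z‖ ^ ((1 : ℤ) - l) = ‖z‖ ^ ((1 : ℝ) - l) := by
    rw [← Real.rpow_intCast]; congr 1; push_cast; ring
  rw [h1, ← h2, mul_comm]

/-- Off the origin, `2H(z)/‖z‖^l = (2H(z))·(‖z‖²)^{−l/2}`. -/
theorem quotient_eq_rpow {z : EuclideanSpace ℝ (Fin 3)} (hz : z ≠ 0) :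
    2 * H z / ‖z‖ ^ l = (2 * H z) * (‖z‖ ^ 2) ^ (-(l : ℝ) / 2) := by
  have hr : 0 < ‖z‖ := norm_pos_iff.2 hz
  have h1 : (‖z‖ ^ 2) ^ (-(l : ℝ) / 2) = (‖z‖ ^ l)⁻¹ := by
    rw [← Real.rpow_natCast ‖z‖ 2, ← Real.rpow_mul hr.le, ← Real.rpow_natCast ‖z‖ l, ← Real.rpow_neg hr.le]
    congr 1; push_cast; ring
  rw [h1, div_eq_mul_inv]

/-- Power bookkeeping at `x ≠ 0`. -/
theorem rpow_bookkeeping {x : EuclideanSpace ℝ (Fin 3)} (hx : x ≠ 0) :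
    (‖x‖ ^ 2) ^ (((1 : ℝ) - l) / 2) = ‖x‖ * (‖x‖ ^ l)⁻¹ ∧
    (‖x‖ ^ 2) ^ (((1 : ℝ) - l) / 2 - 1) = (‖x‖ * ‖x‖ ^ l)⁻¹ ∧
    (‖x‖ ^ 2) ^ (-(l : ℝ) / 2) = (‖x‖ ^ l)⁻¹ ∧
    (‖x‖ ^ 2) ^ (-(l : ℝ) / 2 - 1) = (‖x‖ ^ 2 * ‖x‖ ^ l)⁻¹ := by
  have hr : 0 < ‖x‖ := norm_pos_iff.2 hx
  have hq : ∀ b : ℝ, (‖x‖ ^ 2) ^ b = ‖x‖ ^ (2 * b) := fun b => by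
    rw [← Real.rpow_natCast ‖x‖ 2, ← Real.rpow_mul hr.le]; push_cast; ring_nf
  have hP : ‖x‖ ^ (-(l : ℝ)) = (‖x‖ ^ l)⁻¹ := by rw [Real.rpow_neg hr.le, Real.rpow_natCast]
  refine ⟨?_, ?_, ?_, ?_⟩
  · rw [hq, show 2 * (((1 : ℝ) - l) / 2) = 1 + (-(l : ℝ)) by ring, Real.rpow_add hr, Real.rpow_one, hP]
  · rw [hq, show 2 * (((1 : ℝ) - l) / 2 - 1) = (-1) + (-(l : ℝ)) by ring, Real.rpow_add hr, hP,
      Real.rpow_neg hr.le, Real.rpow_one, mul_inv]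
  · rw [hq, show 2 * (-(l : ℝ) / 2) = -(l : ℝ) by ring, hP]
  · rw [hq, show 2 * (-(l : ℝ) / 2 - 1) = (-2) + (-(l : ℝ)) by ring, Real.rpow_add hr, hP,
      Real.rpow_neg hr.le, mul_inv]
    norm_num

/-- **Conjunct (4) of `HorizonProfileStructure`** — the radial/tangential split of the horizon profile:
`U(x) = (l(l+1)H(x)/‖x‖^l/‖x‖)·x + ‖x‖·∇(2H/‖·‖^l)(x)` off the origin (`H` smooth, `l`-homogeneous, `l ≥ 1`, harmonic). -/
theorem horizonProfile_eq_split (hl : 1 ≤ l) (hH : ContDiff ℝ (⊤ : ℕ∞) H)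
    (hhom : ∀ (c : ℝ) (y : EuclideanSpace ℝ (Fin 3)), H (c • y) = c ^ l * H y)
    (hharm : ∀ y, Laplacian.laplacian H y = 0) {x : EuclideanSpace ℝ (Fin 3)} (hx : x ≠ 0) :
    horizonProfile l H 0 x
      = ((l * (l + 1) : ℝ) * H x / ‖x‖ ^ l / ‖x‖) • x
        + ‖x‖ • gradient (fun z : EuclideanSpace ℝ (Fin 3) => 2 * H z / ‖z‖ ^ l) x := by
  have hr : 0 < ‖x‖ := norm_pos_iff.2 hx
  have hP : 0 < ‖x‖ ^ l := pow_pos hr l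
  have hHd : ∀ z, DifferentiableAt ℝ H z := fun z => (hH.differentiable (by simp)).differentiableAt
  have hopen : ∀ᶠ z in 𝓝 x, z ≠ (0 : EuclideanSpace ℝ (Fin 3)) := isOpen_compl_singleton.mem_nhds hx
  -- the potential and the quotient in `rpow` form near `x`
  have hφ : (fun z : EuclideanSpace ℝ (Fin 3) => ‖z‖ ^ ((1 : ℤ) - l) * H z) =ᶠ[𝓝 x]
      fun z => H z * (‖z‖ ^ 2) ^ (((1 : ℝ) - l) / 2) := by
    filter_upwards [hopen] with z hz using potential_eq_rpow hz
  have hQ : (fun z : EuclideanSpace ℝ (Fin 3) => 2 * H z / ‖z‖ ^ l) =ᶠ[𝓝 x]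
      fun z => (2 * H z) * (‖z‖ ^ 2) ^ (-(l : ℝ) / 2) := by
    filter_upwards [hopen] with z hz using quotient_eq_rpow hz
  have hgradφ : gradient (fun z : EuclideanSpace ℝ (Fin 3) => ‖z‖ ^ ((1 : ℤ) - l) * H z) =ᶠ[𝓝 x]
      gradient (fun z : EuclideanSpace ℝ (Fin 3) => H z * (‖z‖ ^ 2) ^ (((1 : ℝ) - l) / 2)) := by
    filter_upwards [hφ.eventually_nhds] with z hz
    unfold gradient; rw [Filter.EventuallyEq.fderiv_eq hz]
  have hg1 := gradient_mul_rpow_normSq hx (hHd x) (((1 : ℝ) - l) / 2) (H := H)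
  have hψ := divergence_gradient_mul_rpow_normSq hx hH hhom hharm (((1 : ℝ) - l) / 2)
  have h2H : DifferentiableAt ℝ (fun z : EuclideanSpace ℝ (Fin 3) => 2 * H z) x := (hHd x).const_mul 2
  have hg2 := gradient_mul_rpow_normSq hx h2H (-(l : ℝ) / 2) (H := fun z => 2 * H z)
  have hg2H : gradient (fun z : EuclideanSpace ℝ (Fin 3) => 2 * H z) x = (2 : ℝ) • gradient H x := by
    apply ext_inner_right ℝ; intro v
    rw [Literature.Analysis.FluidPDE.inner_gradient_left, real_inner_smul_left,
      Literature.Analysis.FluidPDE.inner_gradient_left, fderiv_const_mul (hHd x)]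
    simp
  have hgQ : gradient (fun z : EuclideanSpace ℝ (Fin 3) => 2 * H z / ‖z‖ ^ l) x
      = gradient (fun z : EuclideanSpace ℝ (Fin 3) => (2 * H z) * (‖z‖ ^ 2) ^ (-(l : ℝ) / 2)) x := by
    unfold gradient; rw [hQ.fderiv_eq]
  obtain ⟨e1, e2, e3, e4⟩ := rpow_bookkeeping (l := l) hx
  have hdivφ : VectorCalculus.divergence (gradient (fun z : EuclideanSpace ℝ (Fin 3) => ‖z‖ ^ ((1 : ℤ) - l) * H z)) x
      = VectorCalculus.divergence (gradient (fun z : EuclideanSpace ℝ (Fin 3) => H z * (‖z‖ ^ 2) ^ (((1 : ℝ) - l) / 2))) x := by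
    simp only [VectorCalculus.divergence, hgradφ.fderiv_eq]
  rw [horizonProfile_eq_normalForm hl hH hhom hx, hgradφ.self_of_nhds, hdivφ,
    hg1, hψ, hgQ, hg2, hg2H, e1, e2, e3, e4]
  -- scalar identities
  set P : ℝ := ‖x‖ ^ l with hPdef
  set r : ℝ := ‖x‖ with hrdef
  have hr0 : r ≠ 0 := hr.ne'
  have hP0 : P ≠ 0 := hP.ne'
  have hβ : 2 * (2 * (((1 : ℝ) - l) / 2 * (r * P)⁻¹) * H x)
        - ((1 : ℝ) - l) / 2 * (4 * l + 4 * (((1 : ℝ) - l) / 2) + 2) * (r * P)⁻¹ * H x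
      = (l * (l + 1) : ℝ) * H x / P / r + r * (2 * (-(l : ℝ) / 2 * (r ^ 2 * P)⁻¹) * (2 * H x)) := by
    field_simp; ring
  calc _ = (2 * (r * P⁻¹)) • gradient H x
        + (2 * (2 * (((1 : ℝ) - l) / 2 * (r * P)⁻¹) * H x)
          - ((1 : ℝ) - l) / 2 * (4 * l + 4 * (((1 : ℝ) - l) / 2) + 2) * (r * P)⁻¹ * H x) • x := by
        module
    _ = (2 * (r * P⁻¹)) • gradient H x
        + ((l * (l + 1) : ℝ) * H x / P / r + r * (2 * (-(l : ℝ) / 2 * (r ^ 2 * P)⁻¹) * (2 * H x))) • x := by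
        rw [hβ]
    _ = _ := by module

/-- **Conjunct (5) of `HorizonProfileStructure`** — the Laplace identity for the tangential potential:
`‖x‖² Δ(2H/‖·‖^l)(x) = −2·l(l+1)H(x)/‖x‖^l` off the origin (`H` smooth, `l`-homogeneous, harmonic). -/
theorem laplacian_tangentialPotential (hH : ContDiff ℝ (⊤ : ℕ∞) H)
    (hhom : ∀ (c : ℝ) (y : EuclideanSpace ℝ (Fin 3)), H (c • y) = c ^ l * H y)
    (hharm : ∀ y, Laplacian.laplacian H y = 0) {x : EuclideanSpace ℝ (Fin 3)} (hx : x ≠ 0) :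
    ‖x‖ ^ 2 * Laplacian.laplacian (fun z : EuclideanSpace ℝ (Fin 3) => 2 * H z / ‖z‖ ^ l) x
      = -2 * ((l * (l + 1) : ℝ) * H x / ‖x‖ ^ l) := by
  have hr : 0 < ‖x‖ := norm_pos_iff.2 hx
  have hP : 0 < ‖x‖ ^ l := pow_pos hr l
  have hopen : ∀ᶠ z in 𝓝 x, z ≠ (0 : EuclideanSpace ℝ (Fin 3)) := isOpen_compl_singleton.mem_nhds hx
  have hQ : (fun z : EuclideanSpace ℝ (Fin 3) => 2 * H z / ‖z‖ ^ l) =ᶠ[𝓝 x]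
      fun z => (fun z : EuclideanSpace ℝ (Fin 3) => 2 * H z) z * (‖z‖ ^ 2) ^ (-(l : ℝ) / 2) := by
    filter_upwards [hopen] with z hz using quotient_eq_rpow hz
  -- data of `H₂ = 2H`
  have h2H : ContDiff ℝ (⊤ : ℕ∞) (fun z : EuclideanSpace ℝ (Fin 3) => 2 * H z) := contDiff_const.mul hH
  have h2hom : ∀ (c : ℝ) (y : EuclideanSpace ℝ (Fin 3)), (fun z => 2 * H z) (c • y) = c ^ l * (fun z => 2 * H z) y := by
    intro c y; simp only [hhom]; ring
  have h2harm : ∀ y, Laplacian.laplacian (fun z : EuclideanSpace ℝ (Fin 3) => 2 * H z) y = 0 := by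
    intro y
    have hfun : (fun z : EuclideanSpace ℝ (Fin 3) => 2 * H z) = (2 : ℝ) • H := by
      funext z; simp [smul_eq_mul]
    have hC2 : ContDiffAt ℝ 2 H y := (hH.of_le (by norm_cast)).contDiffAt
    rw [hfun, InnerProductSpace.laplacian_smul (2 : ℝ) hC2, hharm y, smul_zero]
  -- `Δ = div ∇` at `x` for the quotient (which is `C²` there)
  have hQC2 : ContDiffAt ℝ 2 (fun z : EuclideanSpace ℝ (Fin 3) => 2 * H z / ‖z‖ ^ l) x := by
    have h := ((h2H.of_le (by norm_cast)).contDiffAt.mul (contDiffAt_rpow_normSq hx (-(l : ℝ) / 2) (n := 2)))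
    exact h.congr_of_eventuallyEq hQ
  have hgradQ : gradient (fun z : EuclideanSpace ℝ (Fin 3) => 2 * H z / ‖z‖ ^ l) =ᶠ[𝓝 x]
      gradient (fun z : EuclideanSpace ℝ (Fin 3) => (fun z : EuclideanSpace ℝ (Fin 3) => 2 * H z) z * (‖z‖ ^ 2) ^ (-(l : ℝ) / 2)) := by
    filter_upwards [hQ.eventually_nhds] with z hz
    unfold gradient; rw [Filter.EventuallyEq.fderiv_eq hz]
  obtain ⟨-, -, -, e4⟩ := rpow_bookkeeping (l := l) hx
  have hdivQ : VectorCalculus.divergence (gradient (fun z : EuclideanSpace ℝ (Fin 3) => 2 * H z / ‖z‖ ^ l)) x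
      = VectorCalculus.divergence (gradient (fun z : EuclideanSpace ℝ (Fin 3) =>
          (fun z : EuclideanSpace ℝ (Fin 3) => 2 * H z) z * (‖z‖ ^ 2) ^ (-(l : ℝ) / 2))) x := by
    simp only [VectorCalculus.divergence, hgradQ.fderiv_eq]
  rw [← divergence_gradient_eq_laplacian_of_contDiffAt hQC2, hdivQ,
    divergence_gradient_mul_rpow_normSq hx h2H h2hom h2harm (-(l : ℝ) / 2), e4]
  field_simp
  ring

end Formulas

end Summit.NavierStokesRegularity.NavierStokesRegularity.Theorems.PoloidalLiouville.HorizonTower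

end
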